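import Summits.AtomisticToContinuum.FouriersLaw.Theses.BondHeatUncertainty
import Literature.MathematicalPhysics.KineticTheory.LangevinChainReversal

/-!
# Route `BondHeatUncertainty` — posited objects (vocabulary of the crux lines)

Definitions file of route `BondHeatUncertainty` (sub-problem `FouriersLaw`, summit `AtomisticToContinuum`),
opened by the line lead of crux `LinearResponseFTUR` (stmt-AtomisticToContinuum-9122, line
`lebesgue-flip-duality`). It fixes, once, the FINITE-DIMENSIONAL path-observable vocabulary in which the
line's stubs are registered and landed (`Theorems/BondHeatUncertaintyLinearResponseFTUR*.lean`), so that the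
stub files state short signatures over shared names instead of carrying private copies:

* `Obs N = PhaseSpace N × PhaseSpace N × ℝ × ℝ × ℝ` — the observable space `(x_0, x_t, I_L, I_R, Q^b)`:
  endpoints of a path on `[0, t]`, the two work integrals of the thermostatted momenta, the heat through
  one bond;
* `swapObs` (pure time reversal: endpoints swap, integrals invariant) and `flipObs` (time reversal ∘
  momentum flip `Θ̃`: `(x, y, u, v, e) ↦ (Θy, Θx, -u, -v, -e)`);
* `leftHeat`, `rightHeat` — the bath heats `Q_i = p_i(t)²/2 - p_i(0)²/2 + I_i` read off `Obs N`
  (no stochastic integral: the Itô integral `√(2γT_i)∫p_i dB_i` is eliminated by the energy balance at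
  the bath site);
* `workIntegral P N i t X = ∫₀ᵗ p_i(s) ∂_{q_i}H(X s) ds`, `bondHeat P N i t X = ∫₀ᵗ j_i(X s) ds`,
  `rawObs` — the raw observable `(z, X t, I_{i0}, I_{iN}, Q^{ib})` of a path `X` started at `z`;
* `fwdPath` — the damped path `s ↦ Φ_s(z, B(w))` (`OscillatorChain.solMap`, the flow behind the
  constructed kernels `OscillatorChain.transitionKernel` of `LangevinChainKernel.lean`);
  `revPath` — the reversed-DRIFT path (`sdeSolMap (-Y) v_L v_R`, the flow behind
  `OscillatorChain.langevinRevKernel` of `LangevinChainReversal.lean`; its `Θ`-conjugate is the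
  anti-damped chain);
* `fluxLaw P N i0 iN ib T_L T_R t μ` — the law on `Obs N` of the raw observable of the damped process on
  `[0, t]` started from `μ` (for a steady state: the endpoint–heat marginal of the stationary path measure);
* `eqCurrentAutocorr`, `bondHeatVariance` — VERBATIM the `let`-bound `C N b s` and `V N b t` of the crux
  `BondHeatUncertainty.LinearResponseFTUR` (and of `SubdiffusiveBondHeat`), as closed terms.

Everything is an explicit abbreviation of tree objects; nothing carries axioms; no statement of the route
is restated. Elementary `rfl`/measurability facts about the vocabulary are recorded next to it.
-/

noncomputable section

namespace Summit.AtomisticToContinuum.FouriersLaw.Theorems.BondHeatUncertainty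

open MeasureTheory ProbabilityTheory
open scoped NNReal ENNReal
open Literature.MathematicalPhysics.KineticTheory
open Literature.MathematicalPhysics.KineticTheory.HeatConduction
open Literature.Probability.Process

/-- The observable space `(x_0, x_t, I_L, I_R, Q^b)`: endpoints of a path on `[0, t]`, the two work
integrals of the thermostatted momenta and the heat through one bond. -/
abbrev Obs (N : ℕ) : Type := PhaseSpace N × PhaseSpace N × ℝ × ℝ × ℝ

/-- Pure time reversal on `Obs N`: the endpoints swap, the three integrals are invariant. -/
def swapObs (N : ℕ) (p : Obs N) : Obs N := (p.2.1, p.1, p.2.2)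

/-- Time reversal ∘ momentum flip `Θ̃` on `Obs N`: `(x, y, u, v, e) ↦ (Θ y, Θ x, -u, -v, -e)`. -/
def flipObs (N : ℕ) (p : Obs N) : Obs N :=
  ((p.2.1.1, -p.2.1.2), (p.1.1, -p.1.2), -p.2.2.1, -p.2.2.2.1, -p.2.2.2.2)

/-- Heat absorbed from the bath at site `i0` read off `Obs N`: `p_{i0}(t)²/2 - p_{i0}(0)²/2 + I_L`. -/
def leftHeat {N : ℕ} (i0 : Fin N) (p : Obs N) : ℝ :=
  p.2.1.2 i0 ^ 2 / 2 - p.1.2 i0 ^ 2 / 2 + p.2.2.1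

/-- Heat absorbed from the bath at site `iN` read off `Obs N`: `p_{iN}(t)²/2 - p_{iN}(0)²/2 + I_R`. -/
def rightHeat {N : ℕ} (iN : Fin N) (p : Obs N) : ℝ :=
  p.2.1.2 iN ^ 2 / 2 - p.1.2 iN ^ 2 / 2 + p.2.2.2.1

/-- Work integral of the momentum at site `i` against the Hamiltonian force along a path `X`:
`I_i(X) = ∫₀ᵗ p_i(s) ∂_{q_i}H(X(s)) ds` (so that the heat from a bath at `i` is `Δ(p_i²/2) + I_i`). -/
def workIntegral (P : OscillatorChain) (N : ℕ) (i : Fin N) (t : ℝ) (X : ℝ → PhaseSpace N) : ℝ :=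
  ∫ s in (0 : ℝ)..t, (X s).2 i * partialQ i (P.hamiltonian N) (X s)

/-- Heat through bond `(i, i+1)` along a path: `Q^{(i)}(X) = ∫₀ᵗ j_i(X(s)) ds` (the tree's symmetric bond
current `OscillatorChain.bondCurrent`). -/
def bondHeat (P : OscillatorChain) (N : ℕ) (i : Fin N) (t : ℝ) (X : ℝ → PhaseSpace N) : ℝ :=
  ∫ s in (0 : ℝ)..t, P.bondCurrent N i (X s)

/-- The raw observable of a path `X` started at `z`: `(z, X t, I_{i0}, I_{iN}, Q^{(ib)})`. -/
def rawObs (P : OscillatorChain) (N : ℕ) (i0 iN ib : Fin N) (t : ℝ) (z : PhaseSpace N)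
    (X : ℝ → PhaseSpace N) : Obs N :=
  (z, X t, workIntegral P N i0 t X, workIntegral P N iN t X, bondHeat P N ib t X)

/-- The forward (damped) path from `z` driven by the Brownian pair of the raw sample `w`
(`OscillatorChain.solMap`, the flow behind `OscillatorChain.transitionKernel`). -/
def fwdPath (P : OscillatorChain) (N : ℕ) (T_L T_R : ℝ) (z : PhaseSpace N) (w : WienerPair) :
    ℝ → PhaseSpace N :=
  fun s => P.solMap N T_L T_R s z (pairPath w)

/-- The reversed-drift path from `y`: the flow of `dz = -Y(z) dt + v_L dB^L + v_R dB^R` driven by the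
Brownian pair of `w` (the flow behind `OscillatorChain.langevinRevKernel`; its `Θ`-conjugate is the
ANTI-damped chain). -/
def revPath (P : OscillatorChain) (N : ℕ) (T_L T_R : ℝ) (y : PhaseSpace N) (w : WienerPair) :
    ℝ → PhaseSpace N :=
  fun s => sdeSolMap (fun x => -P.drift N x) (P.bathVecL N T_L) (P.bathVecR N T_R) s y (pairPath w)

/-- The law on `Obs N` of the raw observable of the forward process on `[0, t]` started from `μ`
(for a steady state `μ`: the endpoint–heat marginal of the stationary path measure). -/
def fluxLaw (P : OscillatorChain) (N : ℕ) (i0 iN ib : Fin N) (T_L T_R t : ℝ)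
    (μ : Measure (PhaseSpace N)) : Measure (Obs N) :=
  (μ.prod wienerPair).map fun zw => rawObs P N i0 iN ib t zw.1 (fwdPath P N T_L T_R zw.1 zw.2)

/-- The equilibrium current autocorrelation `C_N(b,s) = ∫ j_b · (P_s j_b) dμ_T` of the pinned chain — the
`let C` of `BondHeatUncertainty.LinearResponseFTUR` / `SubdiffusiveBondHeat`, verbatim. -/
def eqCurrentAutocorr (ω₂ lam β γ T : ℝ) (N b : ℕ) (s : ℝ) : ℝ :=
  if h : b < N then
    ∫ z, (pinnedChain ω₂ lam β γ).bondCurrent N ⟨b, h⟩ z *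
        (∫ y, (pinnedChain ω₂ lam β γ).bondCurrent N ⟨b, h⟩ y
          ∂((pinnedChain ω₂ lam β γ).transitionKernel N T T s.toNNReal z))
      ∂((pinnedChain ω₂ lam β γ).gibbsMeasure N T)
  else 0

/-- The equilibrium bond-heat variance `V_N(b,t) = 2∫₀ᵗ (t-s) C_N(b,s) ds` — the `let V` of
`BondHeatUncertainty.LinearResponseFTUR` / `SubdiffusiveBondHeat`, verbatim. -/
def bondHeatVariance (ω₂ lam β γ T : ℝ) (N b : ℕ) (t : ℝ) : ℝ :=
  2 * ∫ s in (0 : ℝ)..t, (t - s) * eqCurrentAutocorr ω₂ lam β γ T N b s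

/-! ### Elementary facts about the vocabulary -/

/-- `swapObs` is an involution (definitionally). -/
theorem swapObs_swapObs (N : ℕ) (p : Obs N) : swapObs N (swapObs N p) = p := rfl

/-- `Θ̃` and pure time reversal commute (definitionally). -/
theorem flipObs_swapObs (N : ℕ) (p : Obs N) : flipObs N (swapObs N p) = swapObs N (flipObs N p) :=
  rfl

/-- `Θ̃` is an involution of `Obs N`. -/
theorem flipObs_involutive (N : ℕ) : Function.Involutive (flipObs N) := by
  rintro ⟨x, y, u, v, e⟩
  simp [flipObs]

/-- `swapObs` is measurable. -/
theorem measurable_swapObs (N : ℕ) : Measurable (swapObs N) := by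
  unfold swapObs
  fun_prop

/-- `flipObs` is measurable. -/
theorem measurable_flipObs (N : ℕ) : Measurable (flipObs N) := by
  unfold flipObs
  fun_prop

/-- The bond heat coordinate is exactly odd under `Θ̃`. -/
theorem bondCoord_flipObs (N : ℕ) (p : Obs N) : (flipObs N p).2.2.2.2 = -p.2.2.2.2 := rfl

/-- The left bath heat is exactly odd under `Θ̃`. -/
theorem leftHeat_flipObs {N : ℕ} (i0 : Fin N) (p : Obs N) :
    leftHeat i0 (flipObs N p) = -leftHeat i0 p := by
  simp only [leftHeat, flipObs, Pi.neg_apply]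
  ring

/-- The right bath heat is exactly odd under `Θ̃`. -/
theorem rightHeat_flipObs {N : ℕ} (iN : Fin N) (p : Obs N) :
    rightHeat iN (flipObs N p) = -rightHeat iN p := by
  simp only [rightHeat, flipObs, Pi.neg_apply]
  ring

/-- The raw observable, unfolded. -/
theorem rawObs_apply (P : OscillatorChain) (N : ℕ) (i0 iN ib : Fin N) (t : ℝ) (z : PhaseSpace N)
    (X : ℝ → PhaseSpace N) :
    rawObs P N i0 iN ib t z X =
      (z, X t, ∫ s in (0 : ℝ)..t, (X s).2 i0 * partialQ i0 (P.hamiltonian N) (X s),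
        ∫ s in (0 : ℝ)..t, (X s).2 iN * partialQ iN (P.hamiltonian N) (X s),
        ∫ s in (0 : ℝ)..t, P.bondCurrent N ib (X s)) := rfl

/-- The forward path, unfolded. -/
theorem fwdPath_apply (P : OscillatorChain) (N : ℕ) (T_L T_R : ℝ) (z : PhaseSpace N) (w : WienerPair)
    (s : ℝ) : fwdPath P N T_L T_R z w s = P.solMap N T_L T_R s z (pairPath w) := rfl

/-- The reversed-drift path, unfolded. -/
theorem revPath_apply (P : OscillatorChain) (N : ℕ) (T_L T_R : ℝ) (y : PhaseSpace N) (w : WienerPair)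
    (s : ℝ) :
    revPath P N T_L T_R y w s =
      sdeSolMap (fun x => -P.drift N x) (P.bathVecL N T_L) (P.bathVecR N T_R) s y (pairPath w) := rfl

/-- The flux law, unfolded. -/
theorem fluxLaw_eq (P : OscillatorChain) (N : ℕ) (i0 iN ib : Fin N) (T_L T_R t : ℝ)
    (μ : Measure (PhaseSpace N)) :
    fluxLaw P N i0 iN ib T_L T_R t μ =
      (μ.prod wienerPair).map fun zw => rawObs P N i0 iN ib t zw.1 (fwdPath P N T_L T_R zw.1 zw.2) :=
  rfl

/-- `V_N(b,t)` of the crux is `bondHeatVariance`: the crux's `let`-bound `C`, `V` agree with the closed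
terms (definitionally). -/
theorem bondHeatVariance_eq (ω₂ lam β γ T : ℝ) (N b : ℕ) (t : ℝ) :
    bondHeatVariance ω₂ lam β γ T N b t =
      2 * ∫ s in (0 : ℝ)..t, (t - s) * eqCurrentAutocorr ω₂ lam β γ T N b s := rfl

/-- The vocabulary's registered sub-goal on the crux item (def-free signature): pure time reversal
of the observable space is measurable. -/
theorem obs_timeReversal_measurable :
    ∀ N : ℕ, Measurable (fun p : PhaseSpace N × PhaseSpace N × ℝ × ℝ × ℝ => (p.2.1, p.1, p.2.2)) := by
  intro N
  fun_prop

end Summit.AtomisticToContinuum.FouriersLaw.Theorems.BondHeatUncertainty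

end
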